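import Summits.Ventures.MM22.Rank333.Wang333LPCert
import Summits.MatrixMultiplication.OmegaCensus.SmallFormats.GF2Rank234Cert
import Literature.Computability.AlgebraicComplexity.MatMulRankLowerBoundsBlaserProofs
import Literature.Computability.AlgebraicComplexity.SmallFormatMatMulRankUpper
import HarnessLib

/-!
# MM22 venture — `20 ≤ R(⟨3,3,3⟩)` over `ℤ`, `ℤ/2ᵏ` and every two-element field, UNCONDITIONALLY (transport of the kernel `𝔽₂` theorem)

HONEST FRAMING (cell `pub-mm22`, seat LIT-2 g9). No new bound. Since the cell's kernel certificate chain landed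
(`Wang333LPCert.lean`: `Summit.Ventures.MM22.rankGe20F2_holds`, i.e. `20 ≤ R_{𝔽₂}(⟨3,3,3⟩)` — Wang 2026, Thm. 1,
conjunct 2, re-proved in the kernel), the readings of that bound over rings mapping to `𝔽₂`, which the Literature file
`Wang2026MatMulRankF2.lean` states CONDITIONALLY on the named fact `(h : Wang2026_thm1)` (`Wang2026_thm1.of_ringHom`,
`.int`, `.zmod_two_pow`, `.card_two`), hold unconditionally. The transport is Bläser 1999, §5 eq. (10), proved in the
tree (`tensorRank_matMulTensor_map_le`: along a ring homomorphism `f : R → L`, `R_L(⟨k,m,n⟩) ≤ R_R(⟨k,m,n⟩)`), applied to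
`R → ZMod 2`. This file records, as kernel theorems with standard axioms:

* `twenty_le_tensorRank_matMulTensor_three_of_ringHom` — `20 ≤ R_R(⟨3,3,3⟩)` for every commutative semiring `R`
  with a ring homomorphism `R → ZMod 2`;
* `twenty_le_tensorRank_matMulTensor_three_int` — over `ℤ`: no `3 × 3` scheme with integer coefficients and `≤ 19`
  products (the ring of the flip-graph schemes lifted from `ℤ₂`, Kauers–Moosbauer); `window333_int`: `20 ≤ R_ℤ ≤ 23`;
* `twenty_le_tensorRank_matMulTensor_three_zmod_two_pow` — over `ℤ/2ᵏ`, `k ≥ 1` (the Hensel stages `ℤ₂ → ℤ₄ → …`);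
* `twenty_le_tensorRank_matMulTensor_three_of_card_two` — over every field with two elements;
* `window333_F2` — the printed window `20 ≤ R_{𝔽₂}(⟨3,3,3⟩) ≤ 23` (Wang 2026 §8 "still open in `[20, 23]`"; upper
  bound Laderman 1976, proved over every commutative ring), now hypothesis-free;
* `wang2026_thm1_conjuncts_one_two` — the first two conjuncts of the named fact `Wang2026_thm1`
  (`19 ≤ R_{𝔽₂}(⟨2,3,4⟩)`, kernel certificate `GF2Rank234Cert.lean`; `20 ≤ R_{𝔽₂}(⟨3,3,3⟩)`) are kernel theorems;
  conjuncts three and four (`⟨3,3,4⟩ ≥ 25`, `⟨3,4,4⟩ ≥ 29`) remain the named fact — NOT discharged here;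
* `nineteen_le_tensorRank_matMulTensor_234_of_ringHom`, `window234_int` — the same transport for `⟨2,3,4⟩`:
  `19 ≤ R_R(⟨2,3,4⟩)` along any `R → ZMod 2`, and `19 ≤ R_ℤ(⟨2,3,4⟩) ≤ 20` (Hopcroft–Kerr 1971's 20 products, proved
  over every commutative ring).

SCOPE, as printed (Wang 2026 §8, Table 3): the lower bounds are `𝔽₂`-specific and transport only to rings that MAP TO `𝔽₂`;
nothing follows for `ℚ`, `ℝ`, `ℂ`, `𝔽₃`, … where the printed bound for `⟨3,3,3⟩` remains Bläser's `19`
(`blaser2003_cor9_holds`, proved in the tree). The venture target `RankGe21F2` stays open.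

References: [Wang2026] C. Wang, arXiv:2603.07280, Thm. 1, §8; [Blaser1999] M. Bläser, Comput. Complexity 8 (1999),
§5 eq. (10); [Laderman1976] Bull. AMS 82 (1976) 126–128; [HopcroftKerr1971] SIAM J. Appl. Math. 20 (1971) 30–36.
-/

namespace Summit.Ventures.MM22

open Literature.Computability.AlgebraicComplexity
open Summit.MatrixMultiplication.OmegaCensus.GF2RankLB

/-- **Transport into `𝔽₂`, unconditional**: if a commutative semiring `R` admits a ring homomorphism `f : R → ZMod 2`,
every `3 × 3` matrix multiplication scheme over `R` has at least `20` products (`R_{𝔽₂} ≤ R_R` along `f`, Bläser 1999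
§5 (10); `20 ≤ R_{𝔽₂}(⟨3,3,3⟩)` = `rankGe20F2_holds`, kernel). [cite: Blaser1999, §5 eq. (10)] [cite: Wang2026, Thm. 1] -/
theorem twenty_le_tensorRank_matMulTensor_three_of_ringHom {R : Type*} [CommSemiring R] (f : R →+* ZMod 2) :
    20 ≤ tensorRank (matMulTensor R 3 3 3) :=
  twenty_le_tensorRank_matMulTensor_three_F2.trans (tensorRank_matMulTensor_map_le f 3 3 3)

/-- **Over the integers, unconditional**: `20 ≤ R_ℤ(⟨3,3,3⟩)` — no bilinear scheme with integer coefficients multiplies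
`3 × 3` matrices with `≤ 19` products (reduce mod `2`). [cite: Blaser1999, §5 eq. (10)] [cite: Wang2026, Thm. 1] -/
theorem twenty_le_tensorRank_matMulTensor_three_int : 20 ≤ tensorRank (matMulTensor ℤ 3 3 3) :=
  twenty_le_tensorRank_matMulTensor_three_of_ringHom (Int.castRingHom (ZMod 2))

/-- Reading: no `3 × 3` scheme over `ℤ` with `19` (or fewer) products. [cite: Wang2026, Thm. 1] -/
theorem not_tensorRank_matMulTensor_three_int_le_nineteen : ¬ tensorRank (matMulTensor ℤ 3 3 3) ≤ 19 := by
  have h := twenty_le_tensorRank_matMulTensor_three_int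
  omega

/-- **The window over `ℤ`**: `20 ≤ R_ℤ(⟨3,3,3⟩) ≤ 23` (Laderman 1976's 23 products, proved over every commutative ring).
[cite: Wang2026, Thm. 1] [cite: Laderman1976, p. 126] -/
theorem window333_int : 20 ≤ tensorRank (matMulTensor ℤ 3 3 3) ∧ tensorRank (matMulTensor ℤ 3 3 3) ≤ 23 :=
  ⟨twenty_le_tensorRank_matMulTensor_three_int, tensorRank_matMulTensor_three_le_twentyThree ℤ⟩

/-- **Over `ℤ/2ᵏ`** (`k ≥ 1`), the rings of the Hensel-lifting stages `ℤ₂ → ℤ₄ → ℤ₈ → …`, unconditional: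
`20 ≤ R_{ℤ/2ᵏ}(⟨3,3,3⟩)`. [cite: Blaser1999, §5 eq. (10)] [cite: Wang2026, Thm. 1] -/
theorem twenty_le_tensorRank_matMulTensor_three_zmod_two_pow {k : ℕ} (hk : 1 ≤ k) :
    20 ≤ tensorRank (matMulTensor (ZMod (2 ^ k)) 3 3 3) :=
  twenty_le_tensorRank_matMulTensor_three_of_ringHom (ZMod.castHom (dvd_pow_self 2 (by omega)) (ZMod 2))

/-- **Over every field with two elements** (`ZMod 2` up to a ring isomorphism), unconditional: `20 ≤ R_F(⟨3,3,3⟩)`.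
[cite: Blaser1999, §5 eq. (10)] [cite: Wang2026, Thm. 1] -/
theorem twenty_le_tensorRank_matMulTensor_three_of_card_two (F : Type*) [Field F] [Fintype F]
    (hF : Fintype.card F = 2) : 20 ≤ tensorRank (matMulTensor F 3 3 3) :=
  twenty_le_tensorRank_matMulTensor_three_of_ringHom
    ((ZMod.ringEquivOfPrime F Nat.prime_two hF).symm : F →+* ZMod 2)

/-- **The printed window over `𝔽₂`, hypothesis-free**: `20 ≤ R_{𝔽₂}(⟨3,3,3⟩) ≤ 23` (Wang 2026, §8: "the exact rank of
`⟨3,3,3⟩` over `𝔽₂` is still open in `[20, 23]`"; the same statement as `Wang2026_thm1.window333 h`, without `h`).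
[cite: Wang2026, Thm. 1 and §8] [cite: Laderman1976, p. 126] -/
theorem window333_F2 :
    20 ≤ tensorRank (matMulTensor (ZMod 2) 3 3 3) ∧ tensorRank (matMulTensor (ZMod 2) 3 3 3) ≤ 23 :=
  ⟨twenty_le_tensorRank_matMulTensor_three_F2, tensorRank_matMulTensor_three_le_twentyThree (ZMod 2)⟩

/-- **Wang 2026, Thm. 1, conjuncts one and two are kernel theorems**: `19 ≤ R_{𝔽₂}(⟨2,3,4⟩)` (certificate replay
`GF2Rank234Cert.lean`) and `20 ≤ R_{𝔽₂}(⟨3,3,3⟩)` (`rankGe20F2_holds`). Conjuncts three and four of the named fact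
`Wang2026_thm1` (`25 ≤ R_{𝔽₂}(⟨3,3,4⟩)`, `29 ≤ R_{𝔽₂}(⟨3,4,4⟩)`) are NOT proved in the tree. [cite: Wang2026, Thm. 1] -/
theorem wang2026_thm1_conjuncts_one_two :
    19 ≤ tensorRank (matMulTensor (ZMod 2) 2 3 4) ∧ 20 ≤ tensorRank (matMulTensor (ZMod 2) 3 3 3) :=
  ⟨Cert234.le_tensorRank_matMulTensor_234_gf2, twenty_le_tensorRank_matMulTensor_three_F2⟩

/-- **Transport for `⟨2,3,4⟩`**: `19 ≤ R_R(⟨2,3,4⟩)` for every commutative semiring `R` with a ring homomorphism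
`R → ZMod 2`. [cite: Blaser1999, §5 eq. (10)] [cite: Wang2026, Thm. 1] -/
theorem nineteen_le_tensorRank_matMulTensor_234_of_ringHom {R : Type*} [CommSemiring R] (f : R →+* ZMod 2) :
    19 ≤ tensorRank (matMulTensor R 2 3 4) :=
  Cert234.le_tensorRank_matMulTensor_234_gf2.trans (tensorRank_matMulTensor_map_le f 2 3 4)

/-- **The window over `ℤ` for `⟨2,3,4⟩`**: `19 ≤ R_ℤ(⟨2,3,4⟩) ≤ 20` (Hopcroft–Kerr 1971's 20 products, proved over every
commutative ring). [cite: Wang2026, Thm. 1] [cite: HopcroftKerr1971, attribution of the catalogue entry ⟨2×3×4:20⟩] -/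
theorem window234_int : 19 ≤ tensorRank (matMulTensor ℤ 2 3 4) ∧ tensorRank (matMulTensor ℤ 2 3 4) ≤ 20 :=
  ⟨nineteen_le_tensorRank_matMulTensor_234_of_ringHom (Int.castRingHom (ZMod 2)), tensorRank_matMulTensor_234_le ℤ⟩

end Summit.Ventures.MM22
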